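import Mathlib
import Literature.Analysis.FluidPDE.SteadyNSLatticePersistence
import Literature.Analysis.FluidPDE.NSGalerkinFourier
import Literature.Analysis.FunctionSpaces.TorusFourierModes
import HarnessLib

/-!
# Stub `stub_testedOfLatticeEq` of crux `WindLine.WindyGalerkinSteadyZerothLaw`
# (stmt-AnomalousDissipation-11414), line `registered`

A smooth divergence-free field `U` on `T³` whose full Fourier family `Û = 𝓕(complexify ∘ U)`
solves the Leray-projected steady lattice equations
`ν 4π²|k|² Û(k) + Π_k N(Û, Û)(k) = Π_k f̂(k)` for every `k` in the punctured ball
`(freqBall N).erase 0` solves the tested Galerkin equations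
`∫ (⟪U, (U·∇)a⟫ + ν ⟪U, Δa⟫ + ⟪f, a⟫) = 0` against every smooth divergence-free test field `a`
band-limited to that punctured ball.

Proof (pattern of `Torus.sum_re_inner_galerkinField_test` of `NSGalerkinFourier`): split the
integral; turn the convective term around by antisymmetry of the trilinear form
(`Torus.integral_inner_convect_eq_neg`); evaluate each of the three integrals by Parseval against
the band-limited test field (`Torus.integral_inner_eq_sum_of_band_limited`) using the dictionary
`𝓕((U·∇)U) = N(Û, Û)` (`SteadyLattice.mFourierCoeff_convect_real`) and `𝓕(Δa) = -4π²|k|² â`;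
finally, mode by mode, the transversality of `â(k)` lets the Leray multiplier be inserted in
front of every term (`Torus.inner_leraySym_left_of_transversal`, `Torus.lerayCoeff_of_ne_zero`),
and the hypothesis kills the summand.
-/

noncomputable section

-- D-0017: single-problem summit ⇒ the duplicated namespace segment is by design.
set_option linter.dupNamespace false

open scoped InnerProductSpace Topology ComplexConjugate
open MeasureTheory Filter UnitAddTorus
open Literature.Analysis.FunctionSpaces Literature.Analysis.FunctionSpaces.Torus
open Literature.Analysis.FunctionSpaces.EuclideanSpace
open Literature.Analysis.FluidPDE Literature.Analysis.FluidPDE.Torus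
open Literature.Analysis.FluidPDE.ScalarFourier
open Literature.Analysis.FluidPDE.SteadyLattice

namespace Summit.AnomalousDissipation.AnomalousDissipation.Theorems.WindLineWindyGalerkinSteadyZerothLaw

/-- The flat three-torus (local notation). -/
local notation "𝕋³" => UnitAddTorus (Fin 3)
/-- Velocity values (local notation). -/
local notation "E³" => EuclideanSpace ℝ (Fin 3)
/-- Complex coefficient vectors (local notation). -/
local notation "ℂ³" => EuclideanSpace ℂ (Fin 3)
/-- The convective symbol `N(a, b)(k)` as a vector of `ℂ³` (local notation, the tree's `nl`). -/
local notation "nl[" a "," b "," k "]" =>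
  ((WithLp.toLp 2 (fun pp : Fin 3 => transportSym (fun jj mm => (a : (Fin 3 → ℤ) → EuclideanSpace ℂ (Fin 3)) mm jj)
    (fun mm => (b : (Fin 3 → ℤ) → EuclideanSpace ℂ (Fin 3)) mm pp) k)) : EuclideanSpace ℂ (Fin 3))

/-- **Mode-by-mode cancellation.** For `k ≠ 0`, a transversal test coefficient `â` (`k · â = 0`)
and the projected lattice equation `c • Û + Π_k Nk = Π_k f̂` (real Stokes multiplier
`c = ν 4π²|k|²`), the `k`-th summand of the tested identity vanishes:
`-Re⟪Nk, â⟫ + ν Re⟪Û, -(4π²|k|²) â⟫ + Re⟪f̂, â⟫ = 0` — insert `Π_k` in front of `f̂` and `Nk`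
(self-adjointness of the Leray multiplier against transversal vectors) and pair the equation
with `â`. -/
theorem re_inner_mode_eq_zero {ν : ℝ} {k : Fin 3 → ℤ} (hk : k ≠ 0) {Uk Nk fk ak : ℂ³}
    (hak : ∑ i, (k i : ℂ) * ak i = 0)
    (heq : (((ν * (4 * Real.pi ^ 2 * freqNormSq k)) : ℝ) : ℂ) • Uk + lerayCoeff k Nk =
      lerayCoeff k fk) :
    -(inner ℂ Nk ak).re +
        ν * (inner ℂ Uk (-(((4 * Real.pi ^ 2 * freqNormSq k : ℝ) : ℂ) • ak))).re +
        (inner ℂ fk ak).re = 0 := by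
  have key : (inner ℂ (lerayCoeff k fk -
      ((((ν * (4 * Real.pi ^ 2 * freqNormSq k)) : ℝ) : ℂ) • Uk + lerayCoeff k Nk)) ak).re = 0 := by
    rw [heq, sub_self, inner_zero_left, Complex.zero_re]
  rw [inner_sub_left, inner_add_left, lerayCoeff_of_ne_zero hk, lerayCoeff_of_ne_zero hk,
    inner_leraySym_left_of_transversal _ _ hak, inner_leraySym_left_of_transversal _ _ hak,
    inner_smul_left, Complex.conj_ofReal] at key
  rw [inner_neg_right, inner_smul_right]
  simp only [Complex.sub_re, Complex.add_re, Complex.neg_re, Complex.re_ofReal_mul] at key ⊢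
  linear_combination key

/-- **Stub 5 of the line (`stub_testedOfLatticeEq`).** A smooth divergence-free `U` whose full
Fourier family solves the Leray-projected steady lattice equations
`ν4π²|k|² Û(k) + Π_k N(Û,Û)(k) = Π_k f̂(k)` on the punctured ball `(freqBall N).erase 0` solves
the tested Galerkin equations against every smooth divergence-free test field band-limited to
the punctured ball. -/
theorem stub_testedOfLatticeEq :
    ∀ (ν : ℝ) (N : ℕ) (f U : 𝕋³ → E³), IsSmooth f → IsSmooth U → IsDivFree U →
      (∀ k ∈ (freqBall N).erase (0 : Fin 3 → ℤ),
        (((ν * (4 * Real.pi ^ 2 * freqNormSq k)) : ℝ) : ℂ) • mFourierCoeff (complexify ∘ U) k +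
          lerayCoeff k nl[mFourierCoeff (complexify ∘ U), mFourierCoeff (complexify ∘ U), k] =
        lerayCoeff k (mFourierCoeff (complexify ∘ f) k)) →
      ∀ a : 𝕋³ → E³, IsSmooth a → IsDivFree a →
        (∀ k ∉ (freqBall N).erase (0 : Fin 3 → ℤ), mFourierCoeff (complexify ∘ a) k = 0) →
        ∫ x, (⟪U x, convect U a x⟫_ℝ + ν * ⟪U x, laplacian a x⟫_ℝ + ⟪f x, a x⟫_ℝ) = 0 := by
  intro ν N f U hf hU hdivU heq a ha hdiva hband
  -- transversality of the test coefficients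
  have hâT : ∀ k, ∑ i, (k i : ℂ) * mFourierCoeff (complexify ∘ a) k i = 0 :=
    fun k => hdiva.sum_mul_mFourierCoeff_eq_zero ha k
  -- (1) the nonlinear term: antisymmetry, then Parseval against the band-limited `a`
  have hnl : ∫ x, ⟪U x, convect U a x⟫_ℝ =
      -∑ k ∈ (freqBall N).erase (0 : Fin 3 → ℤ),
        (inner ℂ nl[mFourierCoeff (complexify ∘ U), mFourierCoeff (complexify ∘ U), k]
          (mFourierCoeff (complexify ∘ a) k)).re := by
    have h1 := integral_inner_eq_sum_of_band_limited ((hU.convect hU).memLp 2) (ha.memLp 2) hband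
    simp_rw [mFourierCoeff_convect_real hU hU] at h1
    have h2 := integral_inner_convect_eq_neg hU hdivU hU ha
    rw [← h1, h2, neg_neg]
  -- (2) the Stokes term: Parseval against the band-limited `Δa`
  have hlap : ∫ x, ⟪U x, laplacian a x⟫_ℝ =
      ∑ k ∈ (freqBall N).erase (0 : Fin 3 → ℤ), (inner ℂ (mFourierCoeff (complexify ∘ U) k)
        (-(((4 * Real.pi ^ 2 * freqNormSq k : ℝ) : ℂ) • mFourierCoeff (complexify ∘ a) k))).re := by
    have hband' : ∀ k ∉ (freqBall N).erase (0 : Fin 3 → ℤ),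
        mFourierCoeff (complexify ∘ laplacian a) k = 0 := by
      intro k hk
      rw [mFourierCoeff_complexify_laplacian ha, hband k hk, smul_zero, neg_zero]
    rw [integral_inner_eq_sum_of_band_limited (hU.memLp 2) (ha.laplacian.memLp 2) hband']
    refine Finset.sum_congr rfl fun k _ => ?_
    rw [mFourierCoeff_complexify_laplacian ha]
  -- (3) the force term: Parseval
  have hforce : ∫ x, ⟪f x, a x⟫_ℝ =
      ∑ k ∈ (freqBall N).erase (0 : Fin 3 → ℤ), (inner ℂ (mFourierCoeff (complexify ∘ f) k)
        (mFourierCoeff (complexify ∘ a) k)).re :=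
    integral_inner_eq_sum_of_band_limited (hf.memLp 2) (ha.memLp 2) hband
  -- split the integral
  have hi1 : Integrable (fun x => ⟪U x, convect U a x⟫_ℝ) volume := (hU.inner (hU.convect ha)).integrable
  have hi2 : Integrable (fun x => ν * ⟪U x, laplacian a x⟫_ℝ) volume :=
    ((hU.inner ha.laplacian).integrable).const_mul ν
  have hi3 : Integrable (fun x => ⟪f x, a x⟫_ℝ) volume := (hf.inner ha).integrable
  have hi12 : Integrable (fun x => ⟪U x, convect U a x⟫_ℝ + ν * ⟪U x, laplacian a x⟫_ℝ) volume :=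
    hi1.add hi2
  rw [integral_add hi12 hi3, integral_add hi1 hi2, integral_const_mul, hnl, hlap, hforce,
    Finset.mul_sum, ← Finset.sum_neg_distrib, ← Finset.sum_add_distrib, ← Finset.sum_add_distrib]
  refine Finset.sum_eq_zero fun k hk => ?_
  exact re_inner_mode_eq_zero (Finset.mem_erase.1 hk).1 (hâT k) (heq k hk)

end Summit.AnomalousDissipation.AnomalousDissipation.Theorems.WindLineWindyGalerkinSteadyZerothLaw
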